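import Summits.ResolutionOfSingularities.ResolutionOfSingularities.Theorems.MarkedTransferCampaignW46MohWindowShadeTerminal
import HarnessLib

/-!
# [OURS · L1 W4.6] Rung (iii) "Moh window" for the classical pair — the EXIT at the bottom edge
  `ord₀ F = p`, and the no-increase law along a finite walk

Cell `res-hironaka`, rung L, slot W4.6, seat `res-L1-s46-pv-6` (gen 2).  Sequel of
`MarkedTransferCampaignW46MohWindowShade.lean` (gen 0: inside `p ≤ ord₀ F < 2p` the shade never increases
at an equimultiple point; at `ord₀ F = p` it is frozen and no exceptional component is lost), answering two
lane-B reading notes on desk #35 (`CampaignW46MohWindowShadeFrozen` "instance-free for `|σ| ≤ 2`",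
`CampaignW46MohWindowShadeAntitone` "infinite walks only").  Companion (terminal case, all dimensions):
`MarkedTransferCampaignW46MohWindowShadeTerminal.lean`.  Model: the tree's transcription of [Hauser2010,
§§F–G] (`PointBlowup.State/step/shade/IsEquimultiplePoint`, `PointBlowupShade.lean`): the purely
inseparable hypersurface `x^p + F(y)`, `F` cleaned of `p`-th power monomials, point blow-ups read chart by
chart.  OURS; replaces — for regime (iii) of RESCUE-SEED W4.6 and the classical pair — the ROLE of the
termination clause of Th. 16.13 (ms. p. 87 l. 25–29) at the bottom edge of the window and of Th. 16.6 (2) /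
Eq. (127) (p. 84 l. 10–20) along a finite walk; NOT a statement of the manuscript [claim: Hironaka2017,
status: under-review], nothing of which is used.  AI review is weaker than expert review.

## What is proved (prime `p`, field `K` of characteristic `p`, finite index type `σ` of residual variables)

§1 THE BOTTOM EDGE `ord₀ F = p`.
* `exists_initial_apply_eq_zero_of_isEquimultiplePoint` (all dimensions): if the point `b` of the chart
  `y_j` (`b_j = 0`) is equimultiple for a CLEANED state of order exactly `p`, then for every index `k` in
  the support of the direction `e_j + Σ b_i e_i` (`k = j`, or `b_k ≠ 0`) the initial form `F_p` has a
  monomial NOT involving `y_k`.  (Near ⟹ ridge, tree `PointBlowup.nearOnDirectrixAt` = [CJS 2020,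
  Thm. 3.14] in the model, read through the polar `Σ v_k ∂_k F_p = 0` at a monomial of least `y_k`-exponent,
  gen 0's `MohWindowShade.dvd_apply_of_polar_eq_zero`: that exponent is then `0` or `p`, and `y_k^p` is
  deleted by the cleaning.)  Corollaries `exists_initial_apply_chart_eq_zero`,
  `exists_initial_apply_translated_eq_zero`, and the exit criterion
  `not_isEquimultiplePoint_of_forall_initial_pos`: a chart `y_j` whose variable divides every initial
  monomial carries NO equimultiple point.
* `not_isEquimultiplePoint_of_two_vars` — SURFACES `x^p + F(y₁,y₂)`: a cleaned state of order exactly `p`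
  has no equimultiple point in any chart: the next point blow-up lowers the order below `p` EVERYWHERE on
  the exceptional divisor.  For surfaces the bottom edge of the window is an EXIT; the predicate
  `CampaignW46MohWindowShadeFrozen` is vacuous for `|σ| = 2` because the walk ends there, not by accident
  (for `|σ| ≥ 3` it has instances: cylinders `x^p + y₀^{p−1}y₁ + y₂^{2p+1}` over the `y₂`-axis).

§2 SURFACES, TERMINAL CASE (coordinate-monomial states `y^r ∣ F`, `ord₀ F = |r|`, `p < |r| < 2p`; the
equimultiplicity test `p ≤ |r'|` of the companion `…MohWindowShadeTerminal`): `not_isEquimultiplePoint_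
translate_of_shade_zero` (a translated point is never equimultiple: `|r'| = |r| − p < p`),
`isEquimultiplePoint_origin_iff_of_shade_zero` (the origin of the chart `y_j` is equimultiple iff
`2p ≤ |r| + r_i`), `step_r_eq_self_iff_of_two_vars` (the multiplicities REPEAT — the only way a terminal
walk inside the window fails to end, by the companion's `length_le_of_noProperCentre` — iff `r_i = p`, i.e.
iff `{x = y_i = 0}` is a curve along which `x^p + y^r u` is `p`-fold: the classical procedure blows up that
curve, cf. gen 0's `MohWindowShadeCentres`).

§3 `shade_antitone_along_of_window_fin`: gen 0's no-increase law along a FINITE walk (equimultiplicity and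
the window asked only for the `N` steps taken).

Honest scope: the given coordinates of the atlas model; `e = 1`; nothing is claimed about walks through
states of order `p < ord₀ F < 2p` beyond gen 0's no-increase law and the terminal case of the companion.
Barriers (`Literature/Barriers/ResolutionOfSingularities/`): `ResidualOrderUnboundedNarrow.
mohStability_fails_for_each_e` (`e ≥ 3`; here `e = 1`); `KangarooShadeIncrease.Hauser2003_kangarooShadeIncrease`
(order `8 ≥ 2p`, outside the window).
-/

noncomputable section

set_option linter.dupNamespace false -- mandated namespace of this single-conjunct summit

open MvPolynomial Finset

open scoped BigOperators

namespace Summit.ResolutionOfSingularities.ResolutionOfSingularities.Theorems.CampaignW46.MohWindowShadeExit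

open Literature.AlgebraicGeometry.Resolution
open Literature.AlgebraicGeometry.Resolution.PointBlowup
open Literature.AlgebraicGeometry.Resolution.Hauser2010
open Literature.AlgebraicGeometry.Resolution.HauserPerlega2019 (initialForm)
open Literature.Barriers.ResolutionOfSingularities (ordZero_le_of_coeff_ne_zero le_ordZero_of_forall)

variable {σ : Type*} {K : Type*} [Field K] [Fintype σ] [DecidableEq σ] [DecidableEq K]
variable (p : ℕ) [hp : Fact p.Prime] [CharP K p]

/-! ## §1. The bottom edge `ord₀ F = p` -/

/-- **[OURS · L1 W4.6] At the bottom edge an equimultiple point forces an initial monomial free of every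
variable in the support of its direction.**  For a cleaned state of order exactly `p` and an equimultiple
point `b` of the chart `y_j` (`b_j = 0`): for every `k` with `(e_j + Σ_i b_i e_i)_k ≠ 0` — i.e. `k = j` or
`b_k ≠ 0` — some monomial of `F` of degree `p` has `y_k`-exponent `0`.  (If all degree-`p` monomials
involved `y_k`, the vanishing polar read at one of least `y_k`-exponent would make that exponent a positive
multiple of `p`, i.e. the monomial would be `y_k^p`, deleted by the cleaning.)  NOT a statement of the
manuscript. [folklore] -/
theorem exists_initial_apply_eq_zero_of_isEquimultiplePoint (j : σ) (b : σ → K) (hbj : b j = 0)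
    (s : State σ K) (hclean : deletePthPowers p s.F = s.F) (hord : ordZero s.F = p)
    (heq : IsEquimultiplePoint p j b s) {k : σ} (hk : direction j b k ≠ 0) :
    ∃ d ∈ s.F.support, d.degree = p ∧ d k = 0 := by
  classical
  have hdir : OnDirectrix s (direction j b) := nearOnDirectrixAt p j b hbj s hord heq
  unfold OnDirectrix at hdir
  -- the initial form is the degree-`p` component, homogeneous of degree `p`
  have hΦdef : initialForm s.F = homogeneousComponent p s.F := by
    show homogeneousComponent (ordZero s.F).toNat s.F = _
    rw [hord, ENat.toNat_coe]
  have hΦ : (initialForm s.F).IsHomogeneous p := by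
    rw [hΦdef]; exact homogeneousComponent_isHomogeneous p s.F
  -- the polar vanishes
  have hpolar : ∑ i, direction j b i • pderiv i (initialForm s.F) = 0 := by
    have hmem := (mem_additiveSubspace_iff p hΦ (direction j b)).mpr hdir
    unfold additiveSubspace at hmem
    rw [LinearMap.mem_ker] at hmem
    unfold polarMap at hmem
    rw [Fintype.linearCombination_apply] at hmem
    exact hmem
  -- support of the initial form: degree-`p` monomials of `F`
  have hsupp : ∀ d, d ∈ (initialForm s.F).support ↔ d ∈ s.F.support ∧ d.degree = p := by
    intro d
    rw [hΦdef, MvPolynomial.mem_support_iff, coeff_homogeneousComponent, MvPolynomial.mem_support_iff]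
    by_cases hdeg : d.degree = p
    · rw [if_pos hdeg]; exact ⟨fun h => ⟨h, hdeg⟩, fun h => h.1⟩
    · rw [if_neg hdeg]; exact ⟨fun h => absurd rfl h, fun h => absurd h.2 hdeg⟩
  -- it is non-empty
  have hne : (initialForm s.F).support.Nonempty := by
    obtain ⟨⟨d, hd, hddeg⟩, -⟩ := (ordZero_eq_nat_iff _ _).mp hord
    exact ⟨d, (hsupp d).mpr ⟨MvPolynomial.mem_support_iff.mpr hd, hddeg⟩⟩
  -- a monomial of least `y_k`-exponent
  obtain ⟨d₀, hd₀, hmin⟩ := Finset.exists_min_image (initialForm s.F).support (fun d => d k) hne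
  obtain ⟨hd₀F, hd₀deg⟩ := (hsupp d₀).mp hd₀
  refine ⟨d₀, hd₀F, hd₀deg, ?_⟩
  by_contra hpos0
  have hpos : 1 ≤ d₀ k := Nat.one_le_iff_ne_zero.mpr hpos0
  have hdvd : p ∣ d₀ k := MohWindowShade.dvd_apply_of_polar_eq_zero p hk hpolar hd₀ hmin hpos
  -- so `d₀ k = p` and `d₀ = p • e_k`, a `p`-th power exponent: excluded by the cleaning
  have hdegsum : d₀.degree = ∑ i, d₀ i := Finsupp.degree_eq_sum d₀
  have hle : d₀ k ≤ d₀.degree := by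
    rw [hdegsum]
    exact Finset.single_le_sum (f := fun i => d₀ i) (fun i _ => Nat.zero_le (d₀ i)) (Finset.mem_univ k)
  rw [hd₀deg] at hle
  have hkp : d₀ k = p := by
    obtain ⟨c, hc⟩ := hdvd
    have hc1 : c = 1 := by
      rcases Nat.lt_or_ge c 1 with h | h
      · rw [show c = 0 by omega, mul_zero] at hc; omega
      · by_contra h2
        have : p * 2 ≤ p * c := Nat.mul_le_mul_left p (by omega); omega
    rw [hc, hc1, mul_one]
  have hPth : IsPthPowerExponent p d₀ := by
    rw [isPthPowerExponent_iff]
    intro i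
    by_cases hik : i = k
    · rw [hik, hkp]
    · have hsum : d₀.degree = d₀ k + ∑ l ∈ (Finset.univ : Finset σ).erase k, d₀ l := by
        rw [hdegsum]
        exact (Finset.add_sum_erase Finset.univ (fun l => d₀ l) (Finset.mem_univ k)).symm
      have hzero : ∑ l ∈ (Finset.univ : Finset σ).erase k, d₀ l = 0 := by
        rw [hd₀deg, hkp] at hsum; omega
      have hi0 : d₀ i = 0 := by
        have hmem : i ∈ (Finset.univ : Finset σ).erase k :=
          Finset.mem_erase.mpr ⟨hik, Finset.mem_univ i⟩
        have := Finset.single_le_sum (f := fun l => d₀ l) (fun l _ => Nat.zero_le (d₀ l)) hmem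
        rw [hzero] at this
        exact Nat.le_zero.mp this
      rw [hi0]; exact dvd_zero p
  exact not_isPthPowerExponent_of_clean p hclean hd₀F hPth

/-- **[OURS · L1 W4.6] The chart variable.**  At the bottom edge, an equimultiple point of the chart `y_j`
forces a degree-`p` monomial of `F` free of `y_j`.  NOT a statement of the manuscript. [folklore] -/
theorem exists_initial_apply_chart_eq_zero (j : σ) (b : σ → K) (hbj : b j = 0) (s : State σ K)
    (hclean : deletePthPowers p s.F = s.F) (hord : ordZero s.F = p)
    (heq : IsEquimultiplePoint p j b s) : ∃ d ∈ s.F.support, d.degree = p ∧ d j = 0 :=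
  exists_initial_apply_eq_zero_of_isEquimultiplePoint p j b hbj s hclean hord heq
    (by rw [direction, Function.update_self]; exact one_ne_zero)

/-- **[OURS · L1 W4.6] The translated variables.**  At the bottom edge, an equimultiple point `b` of the
chart `y_j` with `b_i ≠ 0` forces a degree-`p` monomial of `F` free of `y_i`.  NOT a statement of the
manuscript. [folklore] -/
theorem exists_initial_apply_translated_eq_zero (j : σ) (b : σ → K) (hbj : b j = 0) (s : State σ K)
    (hclean : deletePthPowers p s.F = s.F) (hord : ordZero s.F = p)
    (heq : IsEquimultiplePoint p j b s) {i : σ} (hbi : b i ≠ 0) :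
    ∃ d ∈ s.F.support, d.degree = p ∧ d i = 0 := by
  have hij : i ≠ j := by rintro rfl; exact hbi hbj
  exact exists_initial_apply_eq_zero_of_isEquimultiplePoint p j b hbj s hclean hord heq
    (by rw [direction, Function.update_of_ne hij]; exact hbi)

/-- **[OURS · L1 W4.6] Exit criterion at the bottom edge (all dimensions).**  If every degree-`p`
monomial of the cleaned residual polynomial `F` (of order exactly `p`) involves the variable `y_j`, the
chart `y_j` of the blow-up of the origin carries no equimultiple point: there the order of `x^p + F` drops
below `p`.  NOT a statement of the manuscript. [folklore] -/
theorem not_isEquimultiplePoint_of_forall_initial_pos (j : σ) (b : σ → K) (hbj : b j = 0)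
    (s : State σ K) (hclean : deletePthPowers p s.F = s.F) (hord : ordZero s.F = p)
    (hpos : ∀ d ∈ s.F.support, d.degree = p → 1 ≤ d j) : ¬ IsEquimultiplePoint p j b s := by
  intro heq
  obtain ⟨d, hd, hdeg, hdj⟩ := exists_initial_apply_chart_eq_zero p j b hbj s hclean hord heq
  have := hpos d hd hdeg
  omega

/-- **[OURS · L1 W4.6] SURFACES: the bottom edge is an exit.**  For TWO residual variables (`σ = {j, i}`,
the surface `x^p + F(y_j, y_i)`), a cleaned state of order exactly `p` has NO equimultiple point in the
chart `y_j` (and, by symmetry, none in the chart `y_i`): the next point blow-up lowers the order of the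
hypersurface below `p` at every point of the exceptional divisor — the walk of `p`-fold points ends.  (A
degree-`p` monomial free of `y_j` would be `y_i^p`, deleted by the cleaning.)  This is why the predicate
`CampaignW46MohWindowShadeFrozen` (desk #35) has no instance for `|σ| ≤ 2` — for `|σ| ≥ 3` it has
(cylinders `x^p + y₀^{p−1}y₁ + …` over the `y₂`-axis).  Replaces, for the classical pair and surfaces, the
role of the termination clause of Th. 16.13 at the bottom edge of regime (iii); NOT a statement of the
manuscript. [folklore] -/
theorem not_isEquimultiplePoint_of_two_vars {j i : σ} (hij : i ≠ j) (htwo : ∀ k, k = j ∨ k = i)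
    (b : σ → K) (hbj : b j = 0) (s : State σ K) (hclean : deletePthPowers p s.F = s.F)
    (hord : ordZero s.F = p) : ¬ IsEquimultiplePoint p j b s := by
  classical
  intro heq
  obtain ⟨d, hd, hdeg, hdj⟩ := exists_initial_apply_chart_eq_zero p j b hbj s hclean hord heq
  -- `d = p • e_i`
  have herase : (Finset.univ : Finset σ).erase j = {i} := by
    ext k
    rw [Finset.mem_erase, Finset.mem_singleton]
    constructor
    · rintro ⟨hkj, -⟩
      rcases htwo k with h | h
      · exact absurd h hkj
      · exact h
    · intro h; rw [h]; exact ⟨hij, Finset.mem_univ i⟩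
  have hdi : d i = p := by
    have h1 := degree_eq_add_sum_erase j d
    rw [herase, Finset.sum_singleton, hdj, zero_add, hdeg] at h1
    exact h1.symm
  have hPth : IsPthPowerExponent p d := by
    rw [isPthPowerExponent_iff]
    intro k
    rcases htwo k with h | h
    · rw [h, hdj]; exact dvd_zero p
    · rw [h, hdi]
  exact not_isPthPowerExponent_of_clean p hclean hd hPth


/-! ## §2. Surfaces: the terminal game on two exceptional multiplicities (via the companion's test) -/

omit hp [CharP K p] in
/-- **[OURS · L1 W4.6] Surfaces, terminal case: a translated point is never equimultiple inside the
window.**  For two residual variables `σ = {j, i}` and a coordinate-monomial state with `p < |r| < 2p`,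
no point `b` of the chart `y_j` with `b_i ≠ 0` is equimultiple (`|r'| = |r| − p < p`): off the old
component the order drops.  NOT a statement of the manuscript. [folklore] -/
theorem not_isEquimultiplePoint_translate_of_shade_zero {j i : σ} (hij : i ≠ j)
    (htwo : ∀ k, k = j ∨ k = i) (b : σ → K) (hbj : b j = 0) (hbi : b i ≠ 0) (s : State σ K)
    (hr : ∀ d ∈ s.F.support, s.r ≤ d) (hord : ordZero s.F = (s.r.degree : ℕ))
    (hlo : p < s.r.degree) (hhi : s.r.degree < 2 * p) : ¬ IsEquimultiplePoint p j b s := by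
  classical
  rw [MohWindowShadeTerminal.isEquimultiplePoint_iff_of_shade_zero p j b hbj s hr hord hlo, not_le]
  have herase : (Finset.univ : Finset σ).erase j = {i} := by
    ext k
    rw [Finset.mem_erase, Finset.mem_singleton]
    constructor
    · rintro ⟨hkj, -⟩
      rcases htwo k with h | h
      · exact absurd h hkj
      · exact h
    · intro h; rw [h]; exact ⟨hij, Finset.mem_univ i⟩
  have h1 := degree_eq_add_sum_erase j (step p j b s).r
  rw [herase, Finset.sum_singleton, MohWindowShadeTerminal.step_r_apply p j b hbj s hord j, MohWindowShadeTerminal.step_r_apply p j b hbj s hord i,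
    if_pos hbj, if_pos rfl, if_neg hbi] at h1
  omega

omit hp [CharP K p] in
/-- **[OURS · L1 W4.6] Surfaces, terminal case: the origin of the chart `y_j` is equimultiple iff
`2p ≤ |r| + r_i`.**  NOT a statement of the manuscript. [folklore] -/
theorem isEquimultiplePoint_origin_iff_of_shade_zero {j i : σ} (hij : i ≠ j)
    (htwo : ∀ k, k = j ∨ k = i) (b : σ → K) (hb0 : ∀ k, b k = 0) (s : State σ K)
    (hr : ∀ d ∈ s.F.support, s.r ≤ d) (hord : ordZero s.F = (s.r.degree : ℕ))
    (hlo : p < s.r.degree) :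
    IsEquimultiplePoint p j b s ↔ 2 * p ≤ s.r.degree + s.r i := by
  classical
  rw [MohWindowShadeTerminal.isEquimultiplePoint_iff_of_shade_zero p j b (hb0 j) s hr hord hlo]
  have herase : (Finset.univ : Finset σ).erase j = {i} := by
    ext k
    rw [Finset.mem_erase, Finset.mem_singleton]
    constructor
    · rintro ⟨hkj, -⟩
      rcases htwo k with h | h
      · exact absurd h hkj
      · exact h
    · intro h; rw [h]; exact ⟨hij, Finset.mem_univ i⟩
  have h1 := degree_eq_add_sum_erase j (step p j b s).r
  rw [herase, Finset.sum_singleton, MohWindowShadeTerminal.step_r_apply p j b (hb0 j) s hord j,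
    MohWindowShadeTerminal.step_r_apply p j b (hb0 j) s hord i, if_pos (hb0 j), if_pos rfl, if_pos (hb0 i), if_neg hij] at h1
  omega

omit hp [CharP K p] in
/-- **[OURS · L1 W4.6] Surfaces, terminal case: the state repeats iff `r_i = p`.**  At the origin of the
chart `y_j` the exceptional multiplicities are unchanged (`r' = r`) iff the OTHER component has
multiplicity exactly `p` — i.e. iff `{x = y_i = 0}` is a curve along which `x^p + y^r u` is `p`-fold, a
permissible curve: the stationary branch of the terminal game (the only way a terminal walk inside the
window fails to end, by `length_le_of_noProperCentre` and `2p ≤ |r| + r_i`) is the one the classical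
procedure avoids by blowing up that curve (gen 0's `MohWindowShadeCentres`).  NOT a statement of the
manuscript. [folklore] -/
theorem step_r_eq_self_iff_of_two_vars {j i : σ} (hij : i ≠ j) (htwo : ∀ k, k = j ∨ k = i)
    (b : σ → K) (hb0 : ∀ k, b k = 0) (s : State σ K) {o : ℕ} (ho : ordZero s.F = o)
    (hodeg : o = s.r.degree) (hpo : p ≤ o) : (step p j b s).r = s.r ↔ s.r i = p := by
  classical
  have herase : (Finset.univ : Finset σ).erase j = {i} := by
    ext k
    rw [Finset.mem_erase, Finset.mem_singleton]
    constructor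
    · rintro ⟨hkj, -⟩
      rcases htwo k with h | h
      · exact absurd h hkj
      · exact h
    · intro h; rw [h]; exact ⟨hij, Finset.mem_univ i⟩
  have hsum : s.r.degree = s.r j + s.r i := by
    rw [degree_eq_add_sum_erase j s.r, herase, Finset.sum_singleton]
  constructor
  · intro h
    have hj : (step p j b s).r j = s.r j := by rw [h]
    rw [MohWindowShadeTerminal.step_r_apply p j b (hb0 j) s ho j, if_pos (hb0 j), if_pos rfl] at hj
    omega
  · intro hi
    ext k
    rw [MohWindowShadeTerminal.step_r_apply p j b (hb0 j) s ho k, if_pos (hb0 k)]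
    rcases htwo k with h | h
    · rw [if_pos h, h]; omega
    · rw [h, if_neg hij]


/-! ## §3. The no-increase law along a FINITE walk (desk #35, lane-B note on `…Antitone`) -/

/-- **[OURS · L1 W4.6] Rung (iii) along a finite walk.**  Gen 0's `shade_antitone_along_of_window` asks
equimultiplicity at EVERY `n`, i.e. speaks about infinite walks only (lane-B reading note, desk #35).  The
same conclusion for a walk of length `N`: if `s_{n+1} = step p (j n) (b n) (s n)` with `b n (j n) = 0`, the
start is cleaned with `y^r ∣ F` and `p ≤ ord₀ F`, the points are equimultiple for `n < N` and the states
stay in the window (`ord₀ F_n < 2p`) for `n < N`, then `shade(s_m) ≤ shade(s_n)` for all `n ≤ m ≤ N`.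
NOT a statement of the manuscript. [folklore] -/
theorem shade_antitone_along_of_window_fin (s : ℕ → State σ K) (j : ℕ → σ) (b : ℕ → σ → K)
    (hb : ∀ n, b n (j n) = 0) (hstep : ∀ n, s (n + 1) = step p (j n) (b n) (s n))
    (hclean : deletePthPowers p (s 0).F = (s 0).F) (hr : ∀ d ∈ (s 0).F.support, (s 0).r ≤ d)
    (hord0 : (p : ℕ∞) ≤ ordZero (s 0).F) {N : ℕ}
    (heq : ∀ n, n < N → IsEquimultiplePoint p (j n) (b n) (s n))
    (hwin : ∀ n, n < N → ordZero (s n).F < (2 * p : ℕ)) {n m : ℕ} (hnm : n ≤ m)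
    (hmN : m ≤ N) : (s m).shade ≤ (s n).shade := by
  -- invariants up to `N`: cleaned, `y^r ∣ F`, order `≥ p`
  have hinv : ∀ n, n ≤ N → deletePthPowers p (s n).F = (s n).F ∧
      (∀ d ∈ (s n).F.support, (s n).r ≤ d) ∧ (p : ℕ∞) ≤ ordZero (s n).F := by
    intro n
    induction n with
    | zero => intro _; exact ⟨hclean, hr, hord0⟩
    | succ n ih =>
      intro hn
      obtain ⟨ih1, ih2, ih3⟩ := ih (by omega)
      have hnN : n < N := by omega
      have hne : ordZero (s n).F ≠ ⊤ := ne_top_of_lt (hwin n hnN)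
      obtain ⟨o, ho'⟩ := WithTop.ne_top_iff_exists.mp hne
      have ho : ordZero (s n).F = o := ho'.symm
      rw [hstep n]
      exact ⟨deletePthPowers_step p (j n) (b n) (s n),
        newMult_le_of_mem_support_step p (j n) (b n) (hb n) (s n) ho ih2,
        le_ordZero_step_of_isEquimultiplePoint p (j n) (b n) (s n) (heq n hnN)⟩
  -- one step inside the window
  have hone : ∀ n, n < N → (s (n + 1)).shade ≤ (s n).shade := by
    intro n hn
    obtain ⟨h1, h2, h3⟩ := hinv n hn.le
    rw [hstep n]
    exact MohWindowShade.shade_step_le_of_window p (j n) (b n) (hb n) (s n) h1 h3 (hwin n hn) h2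
      (heq n hn)
  -- chain
  obtain ⟨k, rfl⟩ := Nat.exists_eq_add_of_le hnm
  clear hnm
  induction k with
  | zero => exact le_rfl
  | succ k ih =>
    have hk : n + k < N := by omega
    have := hone (n + k) hk
    rw [show n + (k + 1) = n + k + 1 by omega]
    exact le_trans this (ih (by omega))

end Summit.ResolutionOfSingularities.ResolutionOfSingularities.Theorems.CampaignW46.MohWindowShadeExit
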